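import Literature.MathematicalPhysics.QuantumFieldTheory.Balaban1983to89.B7Prop5General
import Literature.MathematicalPhysics.QuantumFieldTheory.Balaban1983to89.B7Prop4GeneralCk
import Literature.MathematicalPhysics.QuantumFieldTheory.Balaban1983to89.B7LocalityGeneral
import Summits.QuantumFields.BalabanUV.T4Continuum.Spine.NE7.QLaFlatAveragingL1

/-!
# Spine/NE7/QLaCurvedAveragingL1 — the ℓ¹ ∕ SEGMENT form of [Balaban1985Averaging] Proposition 5 (156) AT A GENERAL REGULAR
# BACKGROUND `U₀`, for the B7 fold's CONCRETE `k`-fold covariant averaging `Q_k(U₀, ·) = B7Prop4GeneralLevels.logCovIter` on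
# `ℤ^d`: `‖Q_k(U₀, B)(c)‖ ≤ ((1 + 2C′₁α₀)·L^k + C₃(L^k)²b)·L^{−kd}·Σ_b ‖B_b‖` — the `U₀ ≠ 1` twin of file 11
# (`QLaFlatAveragingL1`), i.e. NODE S's per-coarse-bond deviation shape AROUND A CURVED BACKGROUND, PROVED in the B7 fold's
# coordinates

Cell `pub-balaban-gaps` (YM blitz Y1, track G2, seat `ne7`, generation 5); text of record
`run/shared/lean/pub/pub-balaban-gaps/ne/NE7.md` v5 §4sexies, census row R39 (half (a), general background).  Thirteenth
`Spine/NE7/` file.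

WHY.  File 11 summed the per-entry bound (156) at the FLAT background (`B7Prop5Flat`, lineage b07), which is NODE S's own case
(constants read at the trivial exterior `U = 1`, criticality).  The `pub-balaban` cell reads NE1a as PRINTED per entry at a
GENERAL regular background `U₀` (row O3c.E3*, record `t4/T4-EST-O3cNE1a.md`), and the tree's B7 fold PROVES that case too:
`B7Prop5General.prop5_general_156` (cell `lit-balaban`, seat p06, owner r04; k-uniform, unconditional, for the concrete
composites `logCovIter` of the one-step covariant maps `Qcov` at the level backgrounds `Ū₀ʲ = avgIter L U₀ j`, under Prop. 2's
regime (52) `pdev U₀ < α₀L^{−2k}` and the displayed smallness of `α₀`, `b`).  The same one-bond telescoping as in file 11 —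
only LINE derivatives are needed, the real segment `t ∈ [0,1] ↦ B′ + t·X·δ_b` stays in the polydisc `sup ‖·‖ ≤ b`, the
reference value is `Q_k(U₀, 0) = 0` (`B7Prop4GeneralCk.logCovIter_zero_field`), and a bond outside the box `Bᵏ(c₋) ∪ Bᵏ(c₊)`
costs nothing (`B7LocalityGeneral.logCovIter_congr`) — gives (§2–§3), at EVERY coarse bond `c` and uniformly in `k`:

  `‖Q_k(U₀, B)(c)‖ ≤ ((1 + θ)·L^k + C₃(L^k)²·b) · L^{−kd} · Σ_{b ∈ Λ, b ⊂ Bᵏ(c₋)∪Bᵏ(c₊)} ‖B_b‖`,  `θ = thetaGen d L α₀` (print's `2C′₁α₀`),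

for `B` vanishing off a finite bond set `Λ`: the `k`-fold covariant (double-bar, `U₀`-framed) average of the perturbed
configuration `e^{B}U₀` deviates from that of the background `U₀` — in logarithmic coordinates, where the background sits at
`0` — by at most `(1 + 2C′₁α₀ + C₃L^kb)·L^{(1−d)k}·ℓ¹(B)`: the rate `θ₁ = L^{1−d}` per step survives a curved background with the
printed constant.  This is the located input of the `H₀ ≠ 1` reading of the shared NE1′∩NE7 item (NE7.md §4quater (ii)∕(iii),
R29: at a curved exterior the loop defect is FIRST order in this deviation — the Schur ∕ conditional-mean channels of row NE1′
— whereas at `U = 1` criticality squares it, files 5∕8).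

HONEST FRAMING.  A theorem about the B7 fold's concrete model of [Balaban1985Averaging] (15)∕(89)∕(127) at a general regular
background on `ℤ^d` (p06's DIVERGENCES inherited verbatim: `𝔸` a complete normed `ℂ`-algebra with `‖1‖ = 1`, background valued
in an `AvgClosed` structure group, corner blocks, `t ∈ ℂ` lines, un-normalised `B`-variables, admissible non-optimal constants
`C₃ = 16C″₁`; Prop. 7 ∕ complex backgrounds untouched); Bałaban's (158)-box domains and the torus are NOT treated; nothing of the
paper is asserted beyond what p06∕r04 proved.  [folklore] bookkeeping (telescoping + mean value) over a kernel theorem; (QL-a) NOT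
IN PRINT ([Balaban1989LargeFieldII] p. 356 defers observables); NE7 NOT proved; spine 0∕9; fixed finite T⁴ — NOT ℝ⁴, NOT
infinite volume, NOT a mass gap, NOT Clay.
-/

noncomputable section

open scoped BigOperators
open NormedSpace Finset Set

namespace Summit.QuantumFields.BalabanUV.T4Continuum.Spine.NE7.B7Curved

open Literature.MathematicalPhysics.QuantumFieldTheory.Balaban1983to89.B7Prop1Explicit (Site e expUnit val_expUnit)
open Literature.MathematicalPhysics.QuantumFieldTheory.Balaban1983to89.B7Prop1Local (InBox AgreeOn loK bondHiK)
open Literature.MathematicalPhysics.QuantumFieldTheory.Balaban1983to89.B7Prop2Explicit (pdev AvgClosed C0 c2')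
open Literature.MathematicalPhysics.QuantumFieldTheory.Balaban1983to89.B7Prop3Flat (c3)
open Literature.MathematicalPhysics.QuantumFieldTheory.Balaban1983to89.B7Prop4GeneralLevels (logCovIter linCovIter)
open Literature.MathematicalPhysics.QuantumFieldTheory.Balaban1983to89.B7Prop4GeneralCk (logCovIter_zero_field)
open Literature.MathematicalPhysics.QuantumFieldTheory.Balaban1983to89.B7LocalityGeneral (logCovIter_congr)
open Literature.MathematicalPhysics.QuantumFieldTheory.Balaban1983to89.B7Prop5GeneralInduction (dCov)
open Literature.MathematicalPhysics.QuantumFieldTheory.Balaban1983to89.B7Prop5GeneralLevels (thetaGen C3Gen)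
open Literature.MathematicalPhysics.QuantumFieldTheory.Balaban1983to89.B7Prop5General (prop5_general_156)
open Literature.MathematicalPhysics.QuantumFieldTheory.Balaban1983to89.B7Prop5Flat (BondIn bump bump_eq_zero_of)
open Summit.QuantumFields.BalabanUV.T4Continuum.Spine.NE7.B7Flat (hasDerivAt_comp_ofReal hasDerivAt_of_shift)

variable {d : ℕ}
variable {𝔸 : Type*} [NormedRing 𝔸] [NormedAlgebra ℂ 𝔸] [CompleteSpace 𝔸] [NormOneClass 𝔸]

section Regime

/-! ## §1 The regime of Proposition 5 at a general background (p06's section variables, verbatim) -/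

variable (L : ℕ) (hL : 2 ≤ L) {G : Subgroup 𝔸ˣ} (hG : AvgClosed d L G) (k : ℕ)
  (U₀ : Site d → Fin d → 𝔸ˣ) (hU₀ : ∀ x κ, U₀ x κ ∈ G) {α₀ : ℝ} (hα : 0 < α₀)
  (hα3 : C0 d * α₀ ≤ 1 / 3) (hα4 : 4 * α₀ ≤ c2' d L) (h52 : pdev U₀ < α₀ * (((L : ℝ) ^ k)⁻¹) ^ 2)
  {b : ℝ} (hb : 0 ≤ b)
  (hsmall : Real.exp (4 * (800 * ((d : ℝ) + 1) ^ 2 * ((d : ℝ) + 4)) * α₀)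
    * (1 + 8 * (131072 * ((d : ℝ) + 1) ^ 2) * ((L : ℝ) ^ k * b)) ≤ 2)
  (hc₃ : 4 * ((L : ℝ) ^ k * b) < c3 d L)
  (h145 : 8 * d * thetaGen d L α₀ * (L : ℝ)⁻¹ ^ 4 ≤ 1)
  (h155 : (2 * (L : ℝ) - 1) * (L : ℝ)⁻¹ ^ 2 + 2 * d * thetaGen d L α₀ * (L : ℝ)⁻¹ ^ 3
    + 1 / 8 * (1 + 2 * d * thetaGen d L α₀ * (L : ℝ)⁻¹ ^ 2 + 2 * d * C3Gen d L * ((L : ℝ) ^ k * b)) * (L : ℝ)⁻¹ ^ 2 ≤ 1)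

/-- The per-entry constant of (156) at a general background in `B`-variables at the top level `j = k`:
`M_k = ((1 + θ)·L^k + C₃·(L^k)²·b)·L^{−kd}` (`θ = thetaGen d L α₀` = print's `2C′₁α₀`; `(Lʲ/Lᵏ)² = 1` at `j = k`). -/
private theorem entry_const_eq (hL : 2 ≤ L) :
    ((1 + thetaGen d L α₀ * ((L : ℝ) ^ k * ((L : ℝ) ^ k)⁻¹) ^ 2) * (L : ℝ) ^ k + C3Gen d L * ((L : ℝ) ^ k) ^ 2 * b)
        * (((L : ℝ) ^ k) ^ d)⁻¹
      = ((1 + thetaGen d L α₀) * (L : ℝ) ^ k + C3Gen d L * ((L : ℝ) ^ k) ^ 2 * b) * (((L : ℝ) ^ k) ^ d)⁻¹ := by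
  have hL0 : (L : ℝ) ≠ 0 := by exact_mod_cast (show L ≠ 0 by omega)
  rw [mul_inv_cancel₀ (pow_ne_zero _ hL0), one_pow, mul_one]

/-! ## §2 One fine bond at a curved background: the segment estimate from p06's per-bond line derivative (156)@gen -/

include hL hG hU₀ hα hα3 hα4 h52 hb hsmall hc₃ h145 h155 in
/-- **ONE-BOND VARIATION OF THE `k`-FOLD COVARIANT AVERAGE AT A GENERAL BACKGROUND**: inside p06's polydisc
(`sup_b ‖B_b‖ ≤ b` with the displayed regime), switching ON one fine bond variable `X` (`‖X‖ ≤ b`) at a bond `⟨y, y+e_μ⟩` where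
`B` vanishes moves EVERY `k`-fold averaged logarithmic bond variable `Q_k(U₀, ·)(c)` by at most
`((1 + θ)·L^k + C₃(L^k)²b)·L^{−kd}·‖X‖` — the per-entry bound (156) at the background `U₀` in `B`-variables
(`B7Prop5General.prop5_general_156` at `j = k`) integrated along the real segment `t ∈ [0,1] ↦ B + t·X·δ_b` (mean-value
inequality). [folklore] -/
theorem norm_logCovIter_add_bump_sub_le (B : Site d → Fin d → 𝔸) (hB : ∀ x κ, ‖B x κ‖ ≤ b) (y : Site d) (μ : Fin d)
    (hy : B y μ = 0) (X : 𝔸) (hX : ‖X‖ ≤ b) (z : Site d) (κ : Fin d) :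
    ‖logCovIter L U₀ (B + bump y μ X) k z κ - logCovIter L U₀ B k z κ‖
      ≤ ((1 + thetaGen d L α₀) * (L : ℝ) ^ k + C3Gen d L * ((L : ℝ) ^ k) ^ 2 * b) * (((L : ℝ) ^ k) ^ d)⁻¹ * ‖X‖ := by
  set D : Site d → Fin d → 𝔸 := bump y μ X with hD
  set Φ : ℂ → 𝔸 := fun τ => logCovIter L U₀ (B + τ • D) k z κ with hΦ
  set F' : ℝ → 𝔸 := fun t => dCov L U₀ (B + (t : ℂ) • D) D k z κ + linCovIter L U₀ D k z κ with hF'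
  -- the real segment stays inside the polydisc
  have hpoly : ∀ t : ℝ, t ∈ Icc (0 : ℝ) 1 → ∀ x κ', ‖(B + (t : ℂ) • D) x κ'‖ ≤ b := by
    intro t ht x κ'
    simp only [Pi.add_apply, Pi.smul_apply, hD, bump]
    split_ifs with h
    · obtain ⟨rfl, rfl⟩ := h
      rw [hy, zero_add, norm_smul, Complex.norm_real, Real.norm_eq_abs, abs_of_nonneg ht.1]
      calc t * ‖X‖ ≤ 1 * ‖X‖ := mul_le_mul_of_nonneg_right ht.2 (norm_nonneg _)
        _ ≤ b := by rw [one_mul]; exact hX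
    · rw [smul_zero, add_zero]; exact hB x κ'
  -- p06's per-bond line derivative at every point of the segment, transported to the base point `t`
  have hderC : ∀ t : ℝ, t ∈ Icc (0 : ℝ) 1 →
      HasDerivAt Φ (F' t) (t : ℂ) ∧
        ‖F' t‖ ≤ ((1 + thetaGen d L α₀) * (L : ℝ) ^ k + C3Gen d L * ((L : ℝ) ^ k) ^ 2 * b)
          * (((L : ℝ) ^ k) ^ d)⁻¹ * ‖X‖ := by
    intro t ht
    obtain ⟨h1, h2⟩ := prop5_general_156 L hL hG k U₀ hU₀ hα hα3 hα4 h52 (B + (t : ℂ) • D) hb (hpoly t ht) hsmall hc₃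
      h145 h155 y μ X le_rfl z κ
    rw [entry_const_eq L k hL] at h2
    refine ⟨hasDerivAt_of_shift ?_, h2⟩
    have h1' : HasDerivAt (fun τ : ℂ => logCovIter L U₀ (B + (t : ℂ) • D + τ • D) k z κ) (F' t) 0 := h1
    refine h1'.congr_of_eventuallyEq (Filter.Eventually.of_forall fun τ => ?_)
    show Φ ((t : ℂ) + τ) = logCovIter L U₀ (B + (t : ℂ) • D + τ • D) k z κ
    simp only [hΦ, add_smul, add_assoc]
  -- read along the real axis and apply the mean-value inequality on `[0, 1]`
  have hderR : ∀ t ∈ Icc (0 : ℝ) 1, HasDerivWithinAt (fun s : ℝ => Φ (s : ℂ)) (F' t) (Icc (0 : ℝ) 1) t :=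
    fun t ht => (hasDerivAt_comp_ofReal (hderC t ht).1).hasDerivWithinAt
  have hmv := norm_image_sub_le_of_norm_deriv_le_segment_01' hderR
    (fun t ht => (hderC t (Ico_subset_Icc_self ht)).2)
  have h1 : Φ ((1 : ℝ) : ℂ) = logCovIter L U₀ (B + D) k z κ := by
    simp only [hΦ, Complex.ofReal_one, one_smul]
  have h0 : Φ ((0 : ℝ) : ℂ) = logCovIter L U₀ B k z κ := by
    simp only [hΦ, Complex.ofReal_zero, zero_smul, add_zero]
  rw [h1, h0] at hmv
  exact hmv

omit [NormOneClass 𝔸] in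
/-- **LOCALITY OF THE ONE-BOND VARIATION AT A GENERAL BACKGROUND** (p. 24 after (43), p. 31; kernel: `B7LocalityGeneral.logCovIter_congr`):
switching on a bond variable at a fine bond NOT contained in the box of the coarse bond `c` does not move `Q_k(U₀, ·)(c)`.
[cite: Balaban1985Averaging, p.24 (after (43)), p.31 (after (91))] -/
theorem logCovIter_add_bump_eq_of_not_bondIn (hL1 : 1 ≤ L) (B : Site d → Fin d → 𝔸) (y : Site d) (μ : Fin d) (X : 𝔸)
    (z : Site d) (κ : Fin d) (hnot : ¬ BondIn (loK L k z) (bondHiK L k z κ) y μ) :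
    logCovIter L U₀ (B + bump y μ X) k z κ = logCovIter L U₀ B k z κ := by
  refine logCovIter_congr L hL1 k z κ (fun x ν _ _ => rfl) fun x ν hx hxe => ?_
  rw [Pi.add_apply, Pi.add_apply, bump_eq_zero_of X fun h => ?_, add_zero]
  obtain ⟨rfl, rfl⟩ := h
  exact hnot ⟨hx, hxe⟩

/-! ## §3 THE ℓ¹ FORM OF (156) AT A GENERAL BACKGROUND: telescoping over the support -/

include hL hG hU₀ hα hα3 hα4 h52 hb hsmall hc₃ h145 h155 in
open scoped Classical in
/-- **THE ℓ¹ ∕ SEGMENT FORM OF [Balaban1985Averaging] PROP. 5 (156) AT A GENERAL REGULAR BACKGROUND, LOCAL VERSION, for the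
concrete `k`-fold covariant averaging `Q_k(U₀, ·)` (127) of the B7 fold on `ℤ^d`** — p. 42: «|(δ/δA_b) Q_k(U₀, ηA, c)| ≤
1 + 2C′₁α₀ + C₃|A|» (per entry; PROVED per bond by `B7Prop5General.prop5_general_156`), SUMMED: in p06's regime (`L ≥ 2`,
`U₀` valued in an `AvgClosed` structure group with `pdev U₀ < α₀L^{−2k}`, `α₀` small as displayed, `sup_b ‖B_b‖ ≤ b` with the
displayed smallness of `L^kb`) and for `B` vanishing off a finite set `Λ` of unit-lattice bonds, at EVERY bond `c` of the
`L^k`-lattice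

  `‖Q_k(U₀, B)(c)‖ ≤ ((1 + θ)·L^k + C₃(L^k)²·b)·L^{−kd} · Σ_{b ∈ Λ, b ⊂ Bᵏ(c₋)∪Bᵏ(c₊)} ‖B_b‖`  (`θ = 2C′₁α₀` = `thetaGen d L α₀`),

i.e. `≤ (1 + 2C′₁α₀ + C₃L^kb)·L^{(1−d)k}·Σ‖B_b‖`, uniformly in `k`: the deviation of the `k`-fold average of the perturbed
configuration `e^{B}U₀` from the `k`-fold average of the BACKGROUND (logarithmic coordinate `0`) decays at NE1a's printed rate
`L^{1−d}` per step with the printed constant.  Proof: induction on `Λ` as in file 11 (`B7Flat.norm_logIter_le_l1_local`), from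
`Q_k(U₀, 0) = 0` (`logCovIter_zero_field`). [cite: Balaban1985Averaging, Prop. 5 (156) p.42, (137)–(138) p.39, (127) p.37, p.24 (after (43))] -/
theorem norm_logCovIter_le_l1_local (Λ : Finset (Site d × Fin d)) :
    ∀ B : Site d → Fin d → 𝔸, (∀ x κ, ‖B x κ‖ ≤ b) → (∀ x κ, (x, κ) ∉ Λ → B x κ = 0) →
      ∀ (z : Site d) (κ : Fin d),
        ‖logCovIter L U₀ B k z κ‖ ≤
          ((1 + thetaGen d L α₀) * (L : ℝ) ^ k + C3Gen d L * ((L : ℝ) ^ k) ^ 2 * b) * (((L : ℝ) ^ k) ^ d)⁻¹ *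
            ∑ s ∈ Λ.filter (fun s => BondIn (loK L k z) (bondHiK L k z κ) s.1 s.2), ‖B s.1 s.2‖ := by
  classical
  have hL1 : 1 ≤ L := le_trans (by norm_num) hL
  set M : ℝ := ((1 + thetaGen d L α₀) * (L : ℝ) ^ k + C3Gen d L * ((L : ℝ) ^ k) ^ 2 * b) * (((L : ℝ) ^ k) ^ d)⁻¹
    with hM
  refine Finset.induction_on Λ ?_ ?_
  · intro B _ hoff z κ
    have hB0 : B = 0 := by
      funext x κ'; exact hoff x κ' (Finset.notMem_empty _)
    rw [hB0, logCovIter_zero_field L U₀ k]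
    simp
  · intro s Λ hs ih B hB hoff z κ
    -- switch off the bond `s`
    set B' : Site d → Fin d → 𝔸 := fun x κ' => if x = s.1 ∧ κ' = s.2 then 0 else B x κ' with hB'def
    have hB'poly : ∀ x κ', ‖B' x κ'‖ ≤ b := by
      intro x κ'; simp only [hB'def]
      split_ifs
      · rw [norm_zero]; exact hb
      · exact hB x κ'
    have hB'off : ∀ x κ', (x, κ') ∉ Λ → B' x κ' = 0 := by
      intro x κ' hx
      simp only [hB'def]
      split_ifs with h
      · rfl
      · refine hoff x κ' fun hmem => ?_
        rcases Finset.mem_insert.1 hmem with h' | h'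
        · exact h ⟨congrArg Prod.fst h', congrArg Prod.snd h'⟩
        · exact hx h'
    have hB's : B' s.1 s.2 = 0 := by simp [hB'def]
    have hdecomp : B' + bump s.1 s.2 (B s.1 s.2) = B := by
      funext x κ'
      simp only [Pi.add_apply, hB'def, bump]
      split_ifs with h
      · obtain ⟨h1, h2⟩ := h; rw [h1, h2, zero_add]
      · rw [add_zero]
    set p : Site d × Fin d → Prop := fun t => BondIn (loK L k z) (bondHiK L k z κ) t.1 t.2 with hp
    have hsum : ∑ t ∈ Λ.filter p, ‖B' t.1 t.2‖ = ∑ t ∈ Λ.filter p, ‖B t.1 t.2‖ := by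
      refine Finset.sum_congr rfl fun t ht => ?_
      have htΛ : t ∈ Λ := (Finset.mem_filter.1 ht).1
      have hts : ¬(t.1 = s.1 ∧ t.2 = s.2) := fun h => hs (by rwa [← Prod.ext h.1 h.2])
      simp only [hB'def, if_neg hts]
    have h1 := ih B' hB'poly hB'off z κ
    rw [hsum] at h1
    by_cases hin : p s
    · -- the bond lies in the box of `c`: §2's segment bound
      have h2 := norm_logCovIter_add_bump_sub_le L hL hG k U₀ hU₀ hα hα3 hα4 h52 hb hsmall hc₃ h145 h155 B' hB'poly
        s.1 s.2 hB's (B s.1 s.2) (hB s.1 s.2) z κ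
      rw [hdecomp] at h2
      have hs' : s ∉ Λ.filter p := fun h => hs (Finset.mem_filter.1 h).1
      rw [Finset.filter_insert, if_pos hin, Finset.sum_insert hs', mul_add]
      calc ‖logCovIter L U₀ B k z κ‖
          ≤ ‖logCovIter L U₀ B k z κ - logCovIter L U₀ B' k z κ‖ + ‖logCovIter L U₀ B' k z κ‖ :=
            norm_le_norm_sub_add _ _
        _ ≤ M * ‖B s.1 s.2‖ + M * ∑ t ∈ Λ.filter p, ‖B t.1 t.2‖ := add_le_add h2 h1
    · -- the bond lies outside the box of `c`: locality, no cost
      have heq : logCovIter L U₀ B k z κ = logCovIter L U₀ B' k z κ := by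
        rw [← hdecomp]; exact logCovIter_add_bump_eq_of_not_bondIn L k U₀ hL1 B' s.1 s.2 (B s.1 s.2) z κ hin
      rw [Finset.filter_insert, if_neg hin, heq]
      exact h1

include hL hG hU₀ hα hα3 hα4 h52 hb hsmall hc₃ h145 h155 in
/-- **THE ℓ¹ FORM OF (156) AT A GENERAL BACKGROUND, GLOBAL VERSION**: as above with the sum over the whole support `Λ`.
[cite: Balaban1985Averaging, Prop. 5 (156) p.42, (137)–(138) p.39, (127) p.37] -/
theorem norm_logCovIter_le_l1 (Λ : Finset (Site d × Fin d)) (B : Site d → Fin d → 𝔸) (hB : ∀ x κ, ‖B x κ‖ ≤ b)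
    (hoff : ∀ x κ, (x, κ) ∉ Λ → B x κ = 0) (z : Site d) (κ : Fin d) :
    ‖logCovIter L U₀ B k z κ‖ ≤
      ((1 + thetaGen d L α₀) * (L : ℝ) ^ k + C3Gen d L * ((L : ℝ) ^ k) ^ 2 * b) * (((L : ℝ) ^ k) ^ d)⁻¹ *
        ∑ s ∈ Λ, ‖B s.1 s.2‖ := by
  classical
  have hθ : 0 ≤ thetaGen d L α₀ := by unfold thetaGen; positivity
  have hC : 0 ≤ C3Gen d L := by unfold C3Gen Literature.MathematicalPhysics.QuantumFieldTheory.Balaban1983to89.B7Prop5GeneralLevels.C1ppGen; positivity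
  refine (norm_logCovIter_le_l1_local L hL hG k U₀ hU₀ hα hα3 hα4 h52 hb hsmall hc₃ h145 h155 Λ B hB hoff z κ).trans
    (mul_le_mul_of_nonneg_left ?_ ?_)
  · exact Finset.sum_le_sum_of_subset_of_nonneg (Finset.filter_subset _ _) fun _ _ _ => norm_nonneg _
  · positivity

include hL hG hU₀ hα hα3 hα4 h52 hb hsmall hc₃ h145 h155 in
/-- **SUPPORT FORM AT A GENERAL BACKGROUND** (the currency of `QLaHolonomyDefect.holDev_le_of_support`): if `B` vanishes off `Λ`
and `‖B_b‖ ≤ D` on `Λ`, every `k`-fold averaged logarithmic bond variable is within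
`((1 + θ)L^k + C₃(L^k)²b)·L^{−kd}·|Λ|·D` of the background's. [folklore] -/
theorem norm_logCovIter_le_card_mul (Λ : Finset (Site d × Fin d)) (B : Site d → Fin d → 𝔸)
    (hB : ∀ x κ, ‖B x κ‖ ≤ b) (hoff : ∀ x κ, (x, κ) ∉ Λ → B x κ = 0) {D : ℝ} (hD : ∀ s ∈ Λ, ‖B s.1 s.2‖ ≤ D)
    (z : Site d) (κ : Fin d) :
    ‖logCovIter L U₀ B k z κ‖ ≤
      ((1 + thetaGen d L α₀) * (L : ℝ) ^ k + C3Gen d L * ((L : ℝ) ^ k) ^ 2 * b) * (((L : ℝ) ^ k) ^ d)⁻¹ * (Λ.card * D) := by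
  have hθ : 0 ≤ thetaGen d L α₀ := by unfold thetaGen; positivity
  have hC : 0 ≤ C3Gen d L := by unfold C3Gen Literature.MathematicalPhysics.QuantumFieldTheory.Balaban1983to89.B7Prop5GeneralLevels.C1ppGen; positivity
  have h := norm_logCovIter_le_l1 L hL hG k U₀ hU₀ hα hα3 hα4 h52 hb hsmall hc₃ h145 h155 Λ B hB hoff z κ
  refine h.trans (mul_le_mul_of_nonneg_left ?_ (by positivity))
  calc ∑ s ∈ Λ, ‖B s.1 s.2‖ ≤ ∑ _s ∈ Λ, D := Finset.sum_le_sum hD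
    _ = Λ.card * D := by rw [Finset.sum_const, nsmul_eq_mul]

/-- The rate reading of the constant: `((1 + θ)L^k + C₃(L^k)²b)·L^{−kd} = (1 + θ + C₃L^kb)·(L^{d−1})^{−k}` (`d ≥ 1`) — NE1a's
printed per-step rate `θ₁ = L^{1−d}` to the power `k`, times the printed per-entry constant `1 + 2C′₁α₀ + C₃|A|` of (156).
[folklore] -/
theorem l1ConstGen_eq (hL1 : 1 ≤ L) (hd : 1 ≤ d) :
    ((1 + thetaGen d L α₀) * (L : ℝ) ^ k + C3Gen d L * ((L : ℝ) ^ k) ^ 2 * b) * (((L : ℝ) ^ k) ^ d)⁻¹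
      = (1 + thetaGen d L α₀ + C3Gen d L * ((L : ℝ) ^ k * b)) * ((((L : ℝ) ^ (d - 1))⁻¹) ^ k) := by
  have hL0 : (L : ℝ) ≠ 0 := by exact_mod_cast (show L ≠ 0 by omega)
  have hLk : (L : ℝ) ^ k ≠ 0 := pow_ne_zero _ hL0
  obtain ⟨d', rfl⟩ : ∃ d', d = d' + 1 := ⟨d - 1, by omega⟩
  have hLd : (L : ℝ) ^ d' ≠ 0 := pow_ne_zero _ hL0
  have hLdk : ((L : ℝ) ^ d') ^ k ≠ 0 := pow_ne_zero _ hLd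
  have hpow : ((L : ℝ) ^ k) ^ (d' + 1) = ((L : ℝ) ^ d') ^ k * (L : ℝ) ^ k := by
    rw [pow_succ, ← pow_mul, ← pow_mul, mul_comm k d']
  simp only [Nat.add_sub_cancel, inv_pow, hpow]
  field_simp

end Regime

end Summit.QuantumFields.BalabanUV.T4Continuum.Spine.NE7.B7Curved

end
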